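import Summits.HodgeConjecture.HodgeConjecture.Theorems.F0P3bQCMJunkObstruction   -- ★ p840152: `charIdentityAt_forces_zero`, `not_charIdentityAt_of_witness`, `traceSum_eq_zero_of_transferExists`
import Literature.NumberTheory.GelbartRogawski1991.PiSCompletionIsThetaType        -- ★ p839836: letter (D-b) `piSCompletion_isThetaTypeAtCM` (+ ★ `Rogawski1990.CMThetaDockingClauses` = DOCK)
import HarnessLib

/-!
# Crux `H413`, programme P2 — the D7α node's DOCK clause and the letter (D-b) INHERIT the Q-CM junk hole of `LocalAPacket.CharIdentityAt` (F0P3b-plan (g11), T8-21):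
# DOCK (`CMThetaDockingClauses`, `CharIdentityAt` as a HYPOTHESIS) is VACUOUSLY TRUE and (D-b) (`piSCompletion_isThetaTypeAtCM`, `CharIdentityAt` in the CONCLUSION) forces the
# packet character to VANISH on every class of test functions that has transfers — kernel-checked, over ★ `Theorems/F0P3bQCMJunkObstruction`

Cell `hodgecm-mathlib` (D-0151), FLOOR 0, crux item H413 = stmt-HodgeConjecture-24833, programme P2; seat F0P2-p06 (g5), 2026-09-01.  PROOF lane: theorems only, no `def`,
no `sorry`, no named fact; `--supports stmt-HodgeConjecture-24833`.  HONEST LABEL: HC_CM is proved only modulo the printed citations until rung 0 closes; this file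
discharges none of them — it is a FINDING about two statement TEXTS, in the sense of F0P3b-plan (g11)'s Q-CM finding (`F0/P3b/qcm/FINDING-QCM-JUNK.F0P3b-plan-g11.md`,
★ p840152; LEAD F0P3a-plan (g9) WORD T8-21), extended to the two P2-side texts that consume the same predicate ★ `LocalAPacket.CharIdentityAt … (fun c f => c.smoothTrace μG f) …`:

* ★ `Rogawski1990.CMThetaDockingClauses` (= the DOCK conjunct of the D7α node of record ★ `F0P2oD7alphaMemDockStatement.StubD7αMemDockPerMeasure`, PKΠ v1.14 `stub_D7αMemDockμ`,
  and of ★ `F0P2oD7alphaMemDockOfRows.stubD7αMemDockPerMeasure_of_rows`) takes `CharIdentityAt ⟨πⁿ ∘ e, some πs⟩ …` as a HYPOTHESIS.  §1: it holds with NO theta input, from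
  (i) `{1}` not open in `U(H)(L⁺_v)` and (ii) ONE `Δ_v`-matching pair `(f^H, f)` with `Tr πⁿ∘e (f) + Tr πs (f) ≠ 0` per candidate `πs` — both print-true side facts
  (`U(H)(L⁺_v)` is a non-discrete `p`-adic group; [Rogawski1990 Prop. 4.9.1 (a)] + `Tr π(𝟙_K) = vol(K)·dim V^K > 0`).  So DOCK AS TYPED is CONTENTLESS at the record data.
* ★ `GelbartRogawski1991.piSCompletion_isThetaTypeAtCM` (letter (D-b), ★ p839836; the `hW` binder of ★ `F0P2oCharIdentityCompletionUnique.cmThetaDockingClauses_of_thetaWitness`)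
  puts `CharIdentityAt ⟨πⁿ ∘ e, some πθ⟩ …` in its CONCLUSION.  §2: together with test-function transfer existence `IsLocalDeltaTransferExists … SmoothG SmoothH` (the shape of
  N6 #102 and of the brick's own `hex` = H₇) and (i), it forces `Tr πⁿ∘e (f) + Tr πθ (f) = 0` for EVERY `f ∈ SmoothG` — print-false (characters of inequivalent irreducibles are
  linearly independent; `Tr(𝟙_K) > 0`).  §3: hence ONE test function with non-vanishing packet trace for every theta candidate `πθ` REFUTES (D-b) at that data.  So (D-b) AS TYPED is
  PRINT-FALSE exactly at the canonical data where print asserts it, and `hex ∧ hW` (H₇ ∧ H₈ of the brick) are jointly unsatisfiable there modulo (i) + positivity.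
REPAIR (same as T8-21 R1–R3, for the pens — typer ∕ desks): Test twins `CharIdentityAtTest` (identity over `IsLocSmooth` pairs only) in `CMThetaDockingClauses`∕`…Package`, in
(D-b), in (D-a) ★ `eq_of_charIdentityAt`∕`cmThetaDockingClauses_of_thetaWitness`, and in the D7α node statement ★ p839951 before `stub_Db` is booked or `stub_D7αMemDockμ` is
discharged closer-side.  Nothing ★ is false: every ★ theorem here and upstream is an implication; the finding is about which LETTER TEXTS carry content.
NOT claimed: an in-tree refutation of (D-b) (it would need the instantiated frame, `¬ IsOpen {1}` for `(cmDatum L 3 H).Local v`, transfer existence at one non-split place, and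
`dim V^K > 0` — none controversial, none a tree theorem today; §3 names them as hypotheses).

## References
* [Rogawski1990] J. Rogawski, Ann. of Math. Stud. 123 (1990): §13.1 Prop. 13.1.3 (d), Prop. 13.1.4 p. 199; §4.3 (4.3.1) p. 43; §4.9 Prop. 4.9.1 (a) p. 55; §12.3 Prop. 12.3.3.
* [GelbartRogawski1991] S. Gelbart, J. Rogawski, Invent. Math. 105 (1991): Lem. 5.1.2 p. 466, Thm. 5.1.1 p. 465.
-/

set_option autoImplicit false

-- the mandated namespace has the single-problem summit's repeated segment (`HodgeConjecture.HodgeConjecture`)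
set_option linter.dupNamespace false

noncomputable section

open NumberField IsDedekindDomain MeasureTheory Topology
open scoped Matrix ComplexOrder

namespace Summit.HodgeConjecture.HodgeConjecture.Cruxes.H413.F0P2oDockJunkInheritance

open Literature.NumberTheory Literature.NumberTheory.Automorphic Literature.NumberTheory.Automorphic.UnitaryGroup
open Literature.NumberTheory.Automorphic.IdeleClassGroup
open Literature.NumberTheory.Automorphic.Liu2021 Literature.NumberTheory.Automorphic.Liu2021.Def411WeilCarriers
open Literature.NumberTheory.GaloisRepresentations
open Literature.NumberTheory.Rogawski1990 Literature.NumberTheory.GelbartRogawski1991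
open Summit.HodgeConjecture.HodgeConjecture.Cruxes.H413.F0P3bQCMJunkObstruction

variable (L : Type) [Field L] [NumberField L] [IsCMField L] (H : Matrix (Fin 3) (Fin 3) L)
  [∀ v : HeightOneSpectrum (𝓞 ↥(maximalRealSubfield L)), MeasurableSpace ((cmDatum L 3 H).Local v)]
  [∀ v : HeightOneSpectrum (𝓞 ↥(maximalRealSubfield L)),
    MeasurableSpace ((cmDatum L 2 (Matrix.of fun i j : Fin 2 => if i.val + j.val + 1 = 2 then (1 : L) else 0)).Local v ×
      (cmDatum L 1 (Matrix.of fun i j : Fin 1 => if i.val + j.val + 1 = 1 then (1 : L) else 0)).Local v)]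
  [∀ (v : HeightOneSpectrum (𝓞 ↥(maximalRealSubfield L)))
      (a : ((cmDatum L 2 (Matrix.of fun i j : Fin 2 => if i.val + j.val + 1 = 2 then (1 : L) else 0)).Local v ×
        (cmDatum L 1 (Matrix.of fun i j : Fin 1 => if i.val + j.val + 1 = 1 then (1 : L) else 0)).Local v)),
    MeasurableSpace (((cmDatum L 2 (Matrix.of fun i j : Fin 2 => if i.val + j.val + 1 = 2 then (1 : L) else 0)).Local v ×
        (cmDatum L 1 (Matrix.of fun i j : Fin 1 => if i.val + j.val + 1 = 1 then (1 : L) else 0)).Local v) ⧸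
      Subgroup.centralizer ({a} : Set ((cmDatum L 2 (Matrix.of fun i j : Fin 2 => if i.val + j.val + 1 = 2 then (1 : L) else 0)).Local v ×
        (cmDatum L 1 (Matrix.of fun i j : Fin 1 => if i.val + j.val + 1 = 1 then (1 : L) else 0)).Local v)))]
  [∀ (v : HeightOneSpectrum (𝓞 ↥(maximalRealSubfield L))) (γ : (cmDatum L 3 H).Local v),
    MeasurableSpace ((cmDatum L 3 H).Local v ⧸ Subgroup.centralizer ({γ} : Set ((cmDatum L 3 H).Local v)))]
  (Δ : ∀ v : HeightOneSpectrum (𝓞 ↥(maximalRealSubfield L)), LocalTransferFactor L H v)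
  (mH : ∀ v : HeightOneSpectrum (𝓞 ↥(maximalRealSubfield L)),
    OrbitalMeasureFamily ((cmDatum L 2 (Matrix.of fun i j : Fin 2 => if i.val + j.val + 1 = 2 then (1 : L) else 0)).Local v ×
      (cmDatum L 1 (Matrix.of fun i j : Fin 1 => if i.val + j.val + 1 = 1 then (1 : L) else 0)).Local v))
  (mG : ∀ v : HeightOneSpectrum (𝓞 ↥(maximalRealSubfield L)), OrbitalMeasureFamily ((cmDatum L 3 H).Local v))
  (νH : ∀ v : HeightOneSpectrum (𝓞 ↥(maximalRealSubfield L)),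
    Measure ((cmDatum L 2 (Matrix.of fun i j : Fin 2 => if i.val + j.val + 1 = 2 then (1 : L) else 0)).Local v ×
      (cmDatum L 1 (Matrix.of fun i j : Fin 1 => if i.val + j.val + 1 = 1 then (1 : L) else 0)).Local v))
  (νG : ∀ v : HeightOneSpectrum (𝓞 ↥(maximalRealSubfield L)), Measure ((cmDatum L 3 H).Local v))
  (ξ : OneDimAutRepH L) (μω : HeckeCharacter L)
  (ξloc : ∀ v : HeightOneSpectrum (𝓞 ↥(maximalRealSubfield L)),
    (cmDatum L 2 (Matrix.of fun i j : Fin 2 => if i.val + j.val + 1 = 2 then (1 : L) else 0)).Local v ×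
      (cmDatum L 1 (Matrix.of fun i j : Fin 1 => if i.val + j.val + 1 = 1 then (1 : L) else 0)).Local v →* ℂˣ)
  {n' : ℕ} (e₁ : Fin 3 × Fin 1 ≃ Fin n') (dV : Fin 3 → L) (hdV : ∀ i, IsCMField.complexConj L (dV i) = dV i) (hdV0 : ∀ i, dV i ≠ 0) (g : GL (Fin 3) L)
  (hg : ((g : Matrix (Fin 3) (Fin 3) L).map (cmConjRingHom L))ᵀ * H * (g : Matrix (Fin 3) (Fin 3) L) = Matrix.diagonal dV)

/-! ## §1 DOCK as typed is contentless: it follows from non-discreteness and ONE matching pair with non-vanishing packet trace, with no theta input -/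

set_option synthInstance.maxHeartbeats 400000 in
set_option maxHeartbeats 8000000 in
/-- **DOCK (`CMThetaDockingClauses`) AS TYPED HOLDS VACUOUSLY.**  If at every non-split `v` the identity of `U(H)(L⁺_v)` is not isolated and, for every Keys-labelled `πⁿ` and every
supercuspidal candidate `πs ≠ πⁿ ∘ e`, SOME `Δ_v`-matching pair `(f^H, f)` has `Tr πⁿ∘e (f) + Tr πs (f) ≠ 0` (print: transfer of test functions [Prop. 4.9.1 (a)] and
`Tr π(𝟙_K) > 0`), then `CMThetaDockingClauses L H Δ mH mG νH νG ξ μω ξloc e₁ dV hdV hdV0 g hg` — because its `CharIdentityAt` hypothesis (quantified over ALL bare functions,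
`tr := smoothTrace`) is then refuted by ★ `not_charIdentityAt_of_witness`, so the theta conclusion is never asked for.  No theta correspondence, no [GR91 Lem. 5.1.2] enters.
[cite: Rogawski1990, §13.1 Prop. 13.1.4 p. 199; §4.9 Prop. 4.9.1 (a) p. 55] [cite: GelbartRogawski1991, Lem. 5.1.2 p. 466] -/
theorem cmThetaDockingClauses_of_nondiscrete_of_witness
    (h1 : ∀ v : HeightOneSpectrum (𝓞 ↥(maximalRealSubfield L)), (∀ w : PlacesOver L v, IsCMField.complexConj L • w.1 = w.1) →
      ¬ IsOpen ({1} : Set ((cmDatum L 3 H).Local v)))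
    (hw : ∀ (v : HeightOneSpectrum (𝓞 ↥(maximalRealSubfield L))), (∀ w : PlacesOver L v, IsCMField.complexConj L • w.1 = w.1) →
      ∀ (T : GL (Fin 3) (LocalRing L v)) (a : LocalRing L v) (ha : IsUnit a)
        (h : formCongr (conjLocal L (IsCMField.complexConj L) v) T (H.map (algebraMap L (LocalRing L v))) =
          a • (Matrix.of fun i j : Fin 3 => if i.val + j.val + 1 = 3 then (1 : L) else 0).map (algebraMap L (LocalRing L v)))
        (πn : IrrClass (Gqs L v)) (πs : IrrClass ((cmDatum L 3 H).Local v)), πs.IsSupercuspidal →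
        πs ≠ IrrClass.comap (cmDatumLocalCongr L v T ha h).symm πn →
        ∃ (fH : (cmDatum L 2 (Matrix.of fun i j : Fin 2 => if i.val + j.val + 1 = 2 then (1 : L) else 0)).Local v ×
            (cmDatum L 1 (Matrix.of fun i j : Fin 1 => if i.val + j.val + 1 = 1 then (1 : L) else 0)).Local v → ℂ)
          (f : (cmDatum L 3 H).Local v → ℂ),
          IsLocalDeltaTransfer L H v (Δ v) (mH v) (mG v) fH f ∧
            (⟨IrrClass.comap (cmDatumLocalCongr L v T ha h).symm πn, some πs⟩ : CMLocalAPacket L H v).traceSum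
              (fun c f => c.smoothTrace (νG v) f) f ≠ 0) :
    CMThetaDockingClauses L H Δ mH mG νH νG ξ μω ξloc e₁ dV hdV hdV0 g hg := by
  intro μ hμ χf _ _ _ _ v hv T a ha h _ _ μZ _ π2 πn _ _ πs hsc hne hCI
  exact absurd hCI (not_charIdentityAt_of_witness L H v (h1 v hv) _ (νG v) (ξloc v) (νH v) (Δ v) (mH v) (mG v) (hw v hv T a ha h πn πs hsc hne))

/-! ## §2 (D-b) as typed forces the packet character to vanish on every class of functions that has transfers -/

set_option synthInstance.maxHeartbeats 400000 in
set_option maxHeartbeats 8000000 in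
/-- **(D-b) (`piSCompletion_isThetaTypeAtCM`) AS TYPED ⇒ VANISHING PACKET CHARACTER.**  At any admissible data of its premises (a pair `(μ, χ_f)` on the two dictionary
equations, a non-split `v`, a form congruence, a Haar `μZ`, a Keys-labelled `(π², πⁿ)` with `πⁿ` not square-integrable), if `{1}` is not open in `U(H)(L⁺_v)` and test-function
transfer EXISTS for a class `SmoothG` (`IsLocalDeltaTransferExists … SmoothG SmoothH` — the shape of N6 #102 and of the D7α brick's own `hex`), then the theta completion `πθ`
that (D-b) provides satisfies `Tr πⁿ∘e (f) + Tr πθ (f) = 0` for EVERY `f ∈ SmoothG` (★ `traceSum_eq_zero_of_transferExists`).  Print says the opposite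
(`Tr(𝟙_K) = vol K · dim V^K > 0` for both members): the `CharIdentityAt` conjunct of (D-b) must be restricted to test functions.
[cite: GelbartRogawski1991, Lem. 5.1.2 p. 466; Thm. 5.1.1 p. 465] [cite: Rogawski1990, §13.1 Prop. 13.1.4 p. 199; §4.9 Prop. 4.9.1 (a) p. 55] -/
theorem traceSum_eq_zero_of_piSCompletion_isThetaTypeAtCM
    (hDb : piSCompletion_isThetaTypeAtCM L H Δ mH mG νH νG ξ μω ξloc e₁ dV hdV hdV0 g hg)
    (μ : Literature.NumberTheory.Automorphic.IdeleClassGroup L →ₜ* Circle) (hμ : IsConjugateSymplectic L μ)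
    (χf : UnitaryGroup.finAdelicOne (↥(maximalRealSubfield L)) L (IsCMField.complexConj L) →* ℂˣ)
    (hχc : Continuous χf) (hχu : ∀ z, ‖((χf z : ℂˣ) : ℂ)‖ = 1)
    (hdμ : ∀ v : HeightOneSpectrum (𝓞 ↥(maximalRealSubfield L)),
        (toHeckeCharacter L μ).semilocalComponent L v = (ξ.bcη⁻¹ * ξ.bcψ⁻¹ * μω).semilocalComponent L v)
    (hdχ : ∀ z : (FiniteAdeleRing (𝓞 L) L)ˣ,
        χf (finAdelicCheck (↥(maximalRealSubfield L)) L (IsCMField.complexConj L)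
            (AlgEquiv.ext fun x => by rw [AlgEquiv.mul_apply, IsCMField.complexConj_apply_apply, AlgEquiv.one_apply]) z) =
          (ξ.bcψ⁻¹ * (ξ.bcη⁻¹ * ξ.bcψ⁻¹ * μω) ^ 2)
            (Units.map (N := AdeleRing (𝓞 L) L) (MonoidHom.inr (InfiniteAdeleRing L) (FiniteAdeleRing (𝓞 L) L)) z))
    (v : HeightOneSpectrum (𝓞 ↥(maximalRealSubfield L))) (hv : ∀ w : PlacesOver L v, IsCMField.complexConj L • w.1 = w.1)
    (T : GL (Fin 3) (LocalRing L v)) (a : LocalRing L v) (ha : IsUnit a)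
    (h : formCongr (conjLocal L (IsCMField.complexConj L) v) T (H.map (algebraMap L (LocalRing L v))) =
      a • (Matrix.of fun i j : Fin 3 => if i.val + j.val + 1 = 3 then (1 : L) else 0).map (algebraMap L (LocalRing L v)))
    [MeasurableSpace (Gqs L v ⧸ Subgroup.center (Gqs L v))] [BorelSpace (Gqs L v ⧸ Subgroup.center (Gqs L v))]
    (μZ : Measure (Gqs L v ⧸ Subgroup.center (Gqs L v))) [μZ.IsHaarMeasure]
    (π2 πn : IrrClass (Gqs L v))
    (hK : KeysCaseTwoLabels L v (μω.semilocalComponent L v) (torusLocalComponent L (IsCMField.complexConj L) v ξ.η)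
      (torusLocalComponent L (IsCMField.complexConj L) v ξ.ψ) π2 πn)
    (hn : ¬ πn.IsSquareIntegrable μZ)
    (h1 : ¬ IsOpen ({1} : Set ((cmDatum L 3 H).Local v)))
    {SmoothG : ((cmDatum L 3 H).Local v → ℂ) → Prop}
    {SmoothH : ((cmDatum L 2 (Matrix.of fun i j : Fin 2 => if i.val + j.val + 1 = 2 then (1 : L) else 0)).Local v ×
        (cmDatum L 1 (Matrix.of fun i j : Fin 1 => if i.val + j.val + 1 = 1 then (1 : L) else 0)).Local v → ℂ) → Prop}
    (hE : IsLocalDeltaTransferExists L H v (Δ v) (mH v) (mG v) SmoothG SmoothH) :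
    ∃ (ε : (↥(maximalRealSubfield L))ˣ) (πθ : IrrClass ((cmDatum L 3 H).Local v)),
      ThetaTypeAtCM L H e₁ dV hdV hdV0 g hg μ hμ χf ε v πθ ∧
        ∀ f, SmoothG f →
          (⟨IrrClass.comap (cmDatumLocalCongr L v T ha h).symm πn, some πθ⟩ : CMLocalAPacket L H v).traceSum
            (fun c f => c.smoothTrace (νG v) f) f = 0 := by
  obtain ⟨ε, πθ, hCI, hθ⟩ := hDb μ hμ χf hχc hχu hdμ hdχ v hv T a ha h μZ π2 πn hK hn
  exact ⟨ε, πθ, hθ, fun f hf => traceSum_eq_zero_of_transferExists L H v h1 _ (νG v) (ξloc v) (νH v) (Δ v) (mH v) (mG v) hE hCI f hf⟩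

/-! ## §3 Refutation shape of (D-b): one test function with non-vanishing packet trace per theta candidate -/

set_option synthInstance.maxHeartbeats 400000 in
set_option maxHeartbeats 8000000 in
/-- **(D-b) AS TYPED IS REFUTED by admissible data** at which `{1}` is not open, test-function transfer exists, and for every theta candidate `πθ` (every line class `ε` with
`ThetaTypeAtCM … ε v πθ`) some `f ∈ SmoothG` has `Tr πⁿ∘e (f) + Tr πθ (f) ≠ 0` — all print-true at Rogawski's canonical data; none a tree theorem today (so this is the
SHAPE of a refutation, not one). [cite: GelbartRogawski1991, Lem. 5.1.2 p. 466] [cite: Rogawski1990, §13.1 Prop. 13.1.4 p. 199; §4.9 Prop. 4.9.1 (a) p. 55] -/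
theorem not_piSCompletion_isThetaTypeAtCM_of_witness
    (μ : Literature.NumberTheory.Automorphic.IdeleClassGroup L →ₜ* Circle) (hμ : IsConjugateSymplectic L μ)
    (χf : UnitaryGroup.finAdelicOne (↥(maximalRealSubfield L)) L (IsCMField.complexConj L) →* ℂˣ)
    (hχc : Continuous χf) (hχu : ∀ z, ‖((χf z : ℂˣ) : ℂ)‖ = 1)
    (hdμ : ∀ v : HeightOneSpectrum (𝓞 ↥(maximalRealSubfield L)),
        (toHeckeCharacter L μ).semilocalComponent L v = (ξ.bcη⁻¹ * ξ.bcψ⁻¹ * μω).semilocalComponent L v)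
    (hdχ : ∀ z : (FiniteAdeleRing (𝓞 L) L)ˣ,
        χf (finAdelicCheck (↥(maximalRealSubfield L)) L (IsCMField.complexConj L)
            (AlgEquiv.ext fun x => by rw [AlgEquiv.mul_apply, IsCMField.complexConj_apply_apply, AlgEquiv.one_apply]) z) =
          (ξ.bcψ⁻¹ * (ξ.bcη⁻¹ * ξ.bcψ⁻¹ * μω) ^ 2)
            (Units.map (N := AdeleRing (𝓞 L) L) (MonoidHom.inr (InfiniteAdeleRing L) (FiniteAdeleRing (𝓞 L) L)) z))
    (v : HeightOneSpectrum (𝓞 ↥(maximalRealSubfield L))) (hv : ∀ w : PlacesOver L v, IsCMField.complexConj L • w.1 = w.1)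
    (T : GL (Fin 3) (LocalRing L v)) (a : LocalRing L v) (ha : IsUnit a)
    (h : formCongr (conjLocal L (IsCMField.complexConj L) v) T (H.map (algebraMap L (LocalRing L v))) =
      a • (Matrix.of fun i j : Fin 3 => if i.val + j.val + 1 = 3 then (1 : L) else 0).map (algebraMap L (LocalRing L v)))
    [MeasurableSpace (Gqs L v ⧸ Subgroup.center (Gqs L v))] [BorelSpace (Gqs L v ⧸ Subgroup.center (Gqs L v))]
    (μZ : Measure (Gqs L v ⧸ Subgroup.center (Gqs L v))) [μZ.IsHaarMeasure]
    (π2 πn : IrrClass (Gqs L v))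
    (hK : KeysCaseTwoLabels L v (μω.semilocalComponent L v) (torusLocalComponent L (IsCMField.complexConj L) v ξ.η)
      (torusLocalComponent L (IsCMField.complexConj L) v ξ.ψ) π2 πn)
    (hn : ¬ πn.IsSquareIntegrable μZ)
    (h1 : ¬ IsOpen ({1} : Set ((cmDatum L 3 H).Local v)))
    {SmoothG : ((cmDatum L 3 H).Local v → ℂ) → Prop}
    {SmoothH : ((cmDatum L 2 (Matrix.of fun i j : Fin 2 => if i.val + j.val + 1 = 2 then (1 : L) else 0)).Local v ×
        (cmDatum L 1 (Matrix.of fun i j : Fin 1 => if i.val + j.val + 1 = 1 then (1 : L) else 0)).Local v → ℂ) → Prop}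
    (hE : IsLocalDeltaTransferExists L H v (Δ v) (mH v) (mG v) SmoothG SmoothH)
    (hpos : ∀ (ε : (↥(maximalRealSubfield L))ˣ) (πθ : IrrClass ((cmDatum L 3 H).Local v)), ThetaTypeAtCM L H e₁ dV hdV hdV0 g hg μ hμ χf ε v πθ →
      ∃ f, SmoothG f ∧
        (⟨IrrClass.comap (cmDatumLocalCongr L v T ha h).symm πn, some πθ⟩ : CMLocalAPacket L H v).traceSum
          (fun c f => c.smoothTrace (νG v) f) f ≠ 0) :
    ¬ piSCompletion_isThetaTypeAtCM L H Δ mH mG νH νG ξ μω ξloc e₁ dV hdV hdV0 g hg := by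
  intro hDb
  obtain ⟨ε, πθ, hθ, hz⟩ := traceSum_eq_zero_of_piSCompletion_isThetaTypeAtCM L H Δ mH mG νH νG ξ μω ξloc e₁ dV hdV hdV0 g hg hDb μ hμ χf hχc hχu
    hdμ hdχ v hv T a ha h μZ π2 πn hK hn h1 hE
  obtain ⟨f, hf, hne⟩ := hpos ε πθ hθ
  exact hne (hz f hf)

end Summit.HodgeConjecture.HodgeConjecture.Cruxes.H413.F0P2oDockJunkInheritance

end
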